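/-
Copyright: the b2b-balaban cell (near-miss cell 7), T⁴-continuum fan-out; row NE7b ROUND-2 swarm, seat
t4-ne7b-formalise-leaf-10 (gen 6) — supplier piece «T3b-SORT-TRANSPORT» for the S6g′ INSTANCE's T3b-3 (T3b holder
leaf-05 g4's OFFER∕REQUEST, journal l.14137 (2); «MINE» l.14231): THE LISTING-FREE CLUSTER-CONTACT PREDICATE OF A MEMBER
AND ITS TRANSPORT TO THE SORTED TWIN.  A supplier module consumed BY NAME; not a claim of T3b.  Released under the
licence of the surrounding project.
-/
import Summits.QuantumFields.BalabanUV.T4Continuum.Support.HistoryMemberPlacementParts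
import Summits.QuantumFields.BalabanUV.T4Continuum.Support.HistoryZoneMassPieces
import Summits.QuantumFields.BalabanUV.T4Continuum.Support.ZoneExtentLaw

/-!
# The member's cluster-contact predicate `ClusterConn`, and its transport to the sorted twin

Summits-side support leaf of the T⁴-continuum cell (rung (B)+1 on a FINITE torus only; NOT infinite volume, NOT the
mass gap, NOT the Clay statement; NOT a proof of the spine estimate NE7b).  Row NE7b, route «COUNT», row S6g′
INSTANCE, piece T3b-3 (holder leaf-05 g4): `PhysTop` clause 1 of leaf-02 g6's `HistoryJoinsRearrange` asks, at every
join of the COUNTED member, that the placed parts' zones at the join step be touch-connected from the host; the counted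
member is the SORTED twin `P.sortR.toPGen cell c`, whose same-step chain has NO binary contact at its inner merge nodes
(F-leaf05g3-1), so the listing-free datum is the touch-connectedness of the CLUSTER's part zones (leaf-04 g3's
`HistoryZoneMassPieces.TConn`, membership-based), read on the part SUB-MEMBERS of T3b-READ (`PGen.subAt`), and it
must be TRANSPORTED from the realised member `P.toPGen cell c` (where H3's `Realises` gives it) to the sorted twin.
This file: the predicate (leaf-05 g4's letters, token for token), its structural calculus, and the transport.
[folklore] structural recursion, list permutations; nothing is quoted from print, nothing printed is asserted, no
`[cite:]` tag, no `Prop`-valued FACT minted — `ClusterConn` is a predicate WITH parameters (trigger c1).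

WHAT (ns `…HistoryAdmissible.PGen` unless said; `Zm : ℕ → PGen γ → Finset β` an abstract member-zone, `touch A B :=
(A ∩ B).Nonempty`).
* §1 `TConn` helpers (ns `…HistoryMemberClusterConn`): `tconn_of_mem_iff` (same members ⇒ same verdict),
  `tconn_of_perm`, `tconn_map_congr`.
* §2 **`ClusterConn Zm g : Prop := ∀ q ∈ croots PEv.step g.toGen, TConn touch ((jparts PEv.step q.2).map fun p =>
  Zm (ftime PEv.step q.2) (subAt g (q.1 ++ p.1)))`**; `clusterConn_birth`, `subAt_renew_of_ne_nil`,
  `fst_ne_nil_of_mem_jparts`, **`clusterConn_renew_iff`**, **`clusterConn_join_iff`** (⇔ the top cluster's part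
  sub-members' zones at the join step are touch-connected ∧ every part sub-member is `ClusterConn`),
  `clusterConn_subAt_of_mem_jparts`, **`clusterConn_chainJoin_iff`** (closed members `A :: Bs`: ⇔ `TConn touch
  ((A :: Bs).map (Zm s))` ∧ every member is `ClusterConn`), `pbirths_subAt_le`, `nodup_map_pbirths_subAt` (`hdis`
  descends to sub-members).  REMARK (located while proving): the unrestricted «`a ∈ naddr g → ClusterConn Zm g →
  ClusterConn Zm (subAt g a)`» is FALSE — for `g = chainJoin A [B₁, B₂] s` and `a = [false]`, `subAt g a = join A B₁ s`
  whose top cluster `{A, B₁}` need not be touch-connected when `{A, B₁, B₂}` is (B₂ in the middle); the valid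
  restrictions are the part addresses (`clusterConn_subAt_of_mem_jparts`) and, by iteration, the join roots.
* §3 on pedigrees (ns `…HistoryGen.Pedigree`), under `HeadOldest` + `RenewDated` and the zone congruence
  `hZ : ∀ t m m', m.pbirths = m'.pbirths → Zm t m = Zm t m'` («the member-zone reads the physical births only»):
  `clusterConn_partPGen_sortR` and **`clusterConn_toPGen_sortR : ClusterConn Zm (P.toPGen cell c) → ClusterConn Zm
  (P.sortR.toPGen cell c)`** (strong induction on the step: same head, tail a permutation — `toPGen_of_cons`∕
  `toPGen_sortR_of_cons`∕`sortTail_perm`; members closed at the step — `partPGen_ne_join_step`; per-part agreement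
  `partPGen_sortR_agree` ⇒ equal zones by `hZ` ⇒ the top zone list of the twin is a permutation of the realised one ⇒
  `TConn` transfers; old parts by induction, renewed parts through `clusterConn_renew_iff`, new parts trivially).
* §4 sanity.

HONEST SCOPE.  The member side only; `Zr`∕`zoneP_placed`∕`clusterConn_of_realises` (leaf-05 g4), `BinContact`∕
`physTop_of_tconn` (leaf-02 g6) are NOT here.  Nothing of H3∕(B)∕BetaPertH touched; `hdis`∕`hmult`∕`resum`∕
`BirthShapeNodup` NOT retired; NE7b NOT proved; spine 0∕9.  HONEST DEPENDENCY (cell): continuum YM on T⁴ ⇐ BetaPertH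
∧ nine spine estimates (0/9 proved); BetaPertH ⇐ (D1) ∧ (D4) ∧ CAP+tail; G-an2-4 gates asym, D1 and NE2/3/4.  This
file changes none of it.
-/

open Literature.MathematicalPhysics.QuantumFieldTheory.Balaban1983to89
open T4PersistenceDictionary
open Summit.QuantumFields.BalabanUV.T4Continuum.HistoryGen
open Summit.QuantumFields.BalabanUV.T4Continuum.HistoryJoins
open Summit.QuantumFields.BalabanUV.T4Continuum.HistoryJoinsAdm
open Summit.QuantumFields.BalabanUV.T4Continuum.HistoryZoneMassPieces (TConn tconn_singleton)
open Summit.QuantumFields.BalabanUV.T4Continuum.ZoneTorus (ftime)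

noncomputable section

/-! ## §1 `TConn` is a verdict on the SET of members -/

namespace Summit.QuantumFields.BalabanUV.T4Continuum.HistoryMemberClusterConn

variable {α δ : Type*} {T : α → α → Prop}

/-- **TOUCH-CONNECTEDNESS DEPENDS ON THE MEMBERS ONLY**: two lists with the same members have the same verdict.
[folklore] -/
theorem tconn_of_mem_iff {l l' : List α} (h : ∀ a, a ∈ l ↔ a ∈ l') (hc : TConn T l) : TConn T l' := by
  intro p hp q hq
  exact Relation.ReflTransGen.mono (fun _ _ hab => ⟨(h _).1 hab.1, (h _).1 hab.2.1, hab.2.2⟩) _ _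
    (hc p ((h p).2 hp) q ((h q).2 hq))

/-- … in particular it is invariant under permutations of the list [folklore] -/
theorem tconn_of_perm {l l' : List α} (h : l.Perm l') (hc : TConn T l) : TConn T l' :=
  tconn_of_mem_iff (fun _ => h.mem_iff) hc

/-- … and two maps agreeing on the list give the same verdict [folklore] -/
theorem tconn_map_congr {l : List δ} {f f' : δ → α} (h : ∀ x ∈ l, f x = f' x) (hc : TConn T (l.map f)) :
    TConn T (l.map f') := by
  rw [← List.map_congr_left h]; exact hc

end Summit.QuantumFields.BalabanUV.T4Continuum.HistoryMemberClusterConn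

open Summit.QuantumFields.BalabanUV.T4Continuum.HistoryMemberClusterConn

/-! ## §2 The cluster-contact predicate of a member -/

namespace Summit.QuantumFields.BalabanUV.T4Continuum.HistoryAdmissible.PGen

variable {γ β : Type*} [DecidableEq β] (Zm : ℕ → PGen γ → Finset β)

/-- **THE CLUSTER-CONTACT PREDICATE** (leaf-05 g4's letters, journal l.14137 (2)): at every join root of the member's
flat tree, the member-zones AT THE JOIN STEP of the top cluster's part SUB-MEMBERS form a touch-connected list
(touch = sharing an element).  Listing-free: `TConn` reads the set of members only. [folklore] -/
def ClusterConn (g : PGen γ) : Prop :=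
  ∀ q ∈ croots PEv.step g.toGen,
    TConn (fun A B : Finset β => (A ∩ B).Nonempty)
      ((jparts PEv.step q.2).map fun p => Zm (ftime PEv.step q.2) (subAt g (q.1 ++ p.1)))

/-- a bare birth has no join [folklore] -/
theorem clusterConn_birth (j d : ℕ) (z : γ) : ClusterConn Zm (birth j d z) := by
  intro q hq; simp [toGen, croots, crootsP] at hq

/-- below a non-empty address a renewal wrapper is transparent [folklore] -/
theorem subAt_renew_of_ne_nil (G : PGen γ) (h : ℕ) {l : List Bool} (hl : l ≠ []) :
    subAt (renew G h) l = subAt G l := by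
  obtain ⟨b, l, rfl⟩ := List.exists_cons_of_ne_nil hl
  rfl

/-- the parts of a merger's top join sit at non-empty addresses [folklore] -/
theorem fst_ne_nil_of_mem_jparts {ε : Type*} (st : ε → ℕ) {X Y : Gen ε} {e : ε} {p : List Bool × Gen ε}
    (hp : p ∈ jparts st (Gen.merge X Y e)) : p.1 ≠ [] := by
  rw [jparts_merge, List.mem_append, List.mem_map, List.mem_map] at hp
  rcases hp with ⟨q, _, rfl⟩ | ⟨q, _, rfl⟩ <;> exact List.cons_ne_nil _ _

/-- the parts of any join root sit at non-empty addresses [folklore] -/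
theorem fst_ne_nil_of_mem_jparts_croots {ε : Type*} (st : ε → ℕ) {G : Gen ε} {q : List Bool × Gen ε}
    (hq : q ∈ croots st G) {p : List Bool × Gen ε} (hp : p ∈ jparts st q.2) : p.1 ≠ [] := by
  obtain ⟨X, Y, e, hq2⟩ := exists_eq_merge_of_mem_crootsP st none G q hq
  rw [hq2] at hp
  exact fst_ne_nil_of_mem_jparts st hp

/-- **A RENEWAL IS AS CLUSTER-CONNECTED AS THE RENEWED MEMBER.** [folklore] -/
theorem clusterConn_renew_iff (G : PGen γ) (h : ℕ) : ClusterConn Zm (renew G h) ↔ ClusterConn Zm G := by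
  have hc : croots PEv.step (renew G h).toGen = croots PEv.step G.toGen := rfl
  unfold ClusterConn
  rw [hc]
  refine forall₂_congr fun q hq => ?_
  rw [List.map_congr_left fun p hp => by
    rw [subAt_renew_of_ne_nil G h (by
      intro h0
      have := fst_ne_nil_of_mem_jparts_croots PEv.step hq hp
      rw [List.append_eq_nil_iff] at h0
      exact this h0.2)]]

/-- **A JOIN IS CLUSTER-CONNECTED IFF ITS TOP CLUSTER'S PART SUB-MEMBERS' ZONES AT THE JOIN STEP ARE TOUCH-CONNECTED
AND EVERY PART SUB-MEMBER IS CLUSTER-CONNECTED.** [folklore] -/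
theorem clusterConn_join_iff (X Y : PGen γ) (s : ℕ) :
    ClusterConn Zm (join X Y s) ↔
      TConn (fun A B : Finset β => (A ∩ B).Nonempty)
          ((jparts PEv.step (join X Y s).toGen).map fun p => Zm s (subAt (join X Y s) p.1)) ∧
        ∀ p ∈ jparts PEv.step (join X Y s).toGen, ClusterConn Zm (subAt (join X Y s) p.1) := by
  have hm := mem_croots_merge_iff PEv.step X.toGen Y.toGen ((s, 2, 0) : PEv)
  have hG : (join X Y s).toGen = Gen.merge X.toGen Y.toGen ((s, 2, 0) : PEv) := rfl
  have hft : ftime PEv.step (Gen.merge X.toGen Y.toGen ((s, 2, 0) : PEv)) = s := rfl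
  -- the shifted lists are the part sub-members' own lists
  have hshift : ∀ p ∈ jparts PEv.step (join X Y s).toGen, ∀ q' ∈ croots PEv.step p.2,
      ((jparts PEv.step q'.2).map fun p' => Zm (ftime PEv.step q'.2) (subAt (join X Y s) ((p.1 ++ q'.1) ++ p'.1))) =
        (jparts PEv.step q'.2).map fun p' =>
          Zm (ftime PEv.step q'.2) (subAt (subAt (join X Y s) p.1) (q'.1 ++ p'.1)) := by
    intro p hp q' _
    refine List.map_congr_left fun p' _ => ?_
    rw [List.append_assoc, subAt_append _ (subAt_of_mem_jparts hp).1]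
  constructor
  · intro H
    refine ⟨?_, fun p hp q' hq' => ?_⟩
    · have := H ([], (join X Y s).toGen) (by rw [hG]; exact (hm _).2 (Or.inl rfl))
      simpa [hG, hft] using this
    · have hq'' : q' ∈ croots PEv.step p.2 := by rwa [← (subAt_of_mem_jparts hp).2]
      have hmem : (p.1 ++ q'.1, q'.2) ∈ croots PEv.step (join X Y s).toGen := by
        rw [hG]; exact (hm _).2 (Or.inr ⟨p, hp, q', hq'', rfl⟩)
      have := H _ hmem
      rw [hshift p hp q' hq''] at this
      exact this
  · rintro ⟨Htop, Hparts⟩ q hq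
    rw [hG] at hq
    rcases (hm q).1 hq with rfl | ⟨p, hp, q', hq', rfl⟩
    · simpa [hG, hft] using Htop
    · rw [hshift p hp q' hq']
      have hq'' : q' ∈ croots PEv.step (subAt (join X Y s) p.1).toGen := by rwa [(subAt_of_mem_jparts hp).2]
      exact Hparts p hp q' hq''

/-- **CLUSTER-CONNECTEDNESS DESCENDS TO THE PART SUB-MEMBERS** of the top join. [folklore] -/
theorem clusterConn_subAt_of_mem_jparts {g : PGen γ} (H : ClusterConn Zm g) {p : List Bool × Gen PEv}
    (hp : p ∈ jparts PEv.step g.toGen) : ClusterConn Zm (subAt g p.1) := by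
  cases g with
  | birth j d z => simp [toGen, jparts] at hp
  | renew G h => simp [toGen, jparts] at hp
  | join X Y s => exact ((clusterConn_join_iff Zm X Y s).1 H).2 p hp

/-- **A CHAIN OF CLOSED MEMBERS IS CLUSTER-CONNECTED IFF THE MEMBERS' ZONES AT THE CHAIN'S STEP ARE TOUCH-CONNECTED
AND EVERY MEMBER IS CLUSTER-CONNECTED.** [folklore] -/
theorem clusterConn_chainJoin_iff (s : ℕ) (A : PGen γ) (Bs : List (PGen γ)) (hBs : Bs ≠ [])
    (hT : ∀ M ∈ A :: Bs, ∀ X Y, M ≠ join X Y s) :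
    ClusterConn Zm (chainJoin A Bs s) ↔
      TConn (fun A B : Finset β => (A ∩ B).Nonempty) ((A :: Bs).map (Zm s)) ∧ ∀ M ∈ A :: Bs, ClusterConn Zm M := by
  obtain ⟨C, B, e⟩ := exists_chainJoin_eq_join s A Bs hBs
  have key := clusterConn_join_iff Zm C B s
  rw [← e] at key
  rw [key]
  have hm := map_subAt_jparts_chainJoin s A Bs hBs hT
  have h1 : ((jparts PEv.step (chainJoin A Bs s).toGen).map fun p => Zm s (subAt (chainJoin A Bs s) p.1)) =
      (A :: Bs).map (Zm s) := by
    rw [← hm, List.map_map]; rfl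
  rw [h1, ← hm, List.forall_mem_map]

/-- the physical births of a sub-member are among the member's [folklore] -/
theorem pbirths_subAt_le : ∀ {g : PGen γ} {a : List Bool}, a ∈ naddr g → (subAt g a).pbirths ≤ g.pbirths
  | g, [], _ => by simp
  | birth _ _ _, _ :: _, ha => by simp at ha
  | renew G h, b :: l, ha => by
      rw [subAt_renew_cons, pbirths_renew]
      exact pbirths_subAt_le (g := G) ha
  | join X Y s, false :: l, ha => by
      rw [subAt_join_false, pbirths_join]
      exact (pbirths_subAt_le (g := X) ((false_cons_mem_naddr_join X Y s l).1 ha)).trans (Multiset.le_add_right _ _)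
  | join X Y s, true :: l, ha => by
      rw [subAt_join_true, pbirths_join]
      exact (pbirths_subAt_le (g := Y) ((true_cons_mem_naddr_join X Y s l).1 ha)).trans (Multiset.le_add_left _ _)

/-- **`hdis` DESCENDS TO SUB-MEMBERS**: a duplicate-free value multiset of the member gives one for every sub-member.
[folklore] -/
theorem nodup_map_pbirths_subAt {ν : Type*} (w : PEv × γ → ν) {g : PGen γ} {a : List Bool} (ha : a ∈ naddr g)
    (h : (g.pbirths.map w).Nodup) : ((subAt g a).pbirths.map w).Nodup :=
  Multiset.nodup_of_le (Multiset.map_le_map (pbirths_subAt_le ha)) h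

end Summit.QuantumFields.BalabanUV.T4Continuum.HistoryAdmissible.PGen

/-! ## §3 On pedigrees: the transport to the sorted twin -/

namespace Summit.QuantumFields.BalabanUV.T4Continuum.HistoryGen.Pedigree

open Summit.QuantumFields.BalabanUV.T4Continuum.HistoryAdmissible

variable {α π γ β : Type*} [Inhabited γ] [DecidableEq β] (P : Pedigree α π) (cell : π → γ)
  (Zm : ℕ → PGen γ → Finset β)

/-- **TRANSPORT ON ONE PART**, given the transport on all EARLIER components: a new region is the same birth on both
sides, an old part is the earlier component's member (hypothesis), a renewed old part goes through
`clusterConn_renew_iff`. [folklore] -/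
theorem clusterConn_partPGen_sortR (c : α)
    (ih : ∀ c', P.step c' < P.step c →
      PGen.ClusterConn Zm (P.toPGen cell c') → PGen.ClusterConn Zm (P.sortR.toPGen cell c'))
    {q : Part α π} (hq : q ∈ P.parts c) :
    PGen.ClusterConn Zm (P.partPGen cell c (P.toPGen cell) q) →
      PGen.ClusterConn Zm (P.sortR.partPGen cell c (P.sortR.toPGen cell) q) := by
  rcases q with ⟨c', _ | _⟩ | ⟨d, x⟩
  · exact ih c' (P.step_lt c c' false hq)
  · intro h
    have h' := (PGen.clusterConn_renew_iff Zm _ _).1 h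
    exact (PGen.clusterConn_renew_iff Zm _ _).2 (ih c' (P.step_lt c c' true hq) h')
  · exact id

/-- **THE TRANSPORT TO THE SORTED TWIN**: under «oldest line first» and renewal dating (the fields `headOldest`∕
`renew_step` of H3's `RealisedDomainsR`) and a member-zone reading the physical births only, the realised member's
cluster-connectedness is the sorted twin's. [folklore] -/
theorem clusterConn_toPGen_sortR (hH : ∀ c, P.HeadOldest c) (hS : P.RenewDated)
    (hZ : ∀ t m m', m.pbirths = m'.pbirths → Zm t m = Zm t m') (c : α) :
    PGen.ClusterConn Zm (P.toPGen cell c) → PGen.ClusterConn Zm (P.sortR.toPGen cell c) := by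
  intro H
  -- transport on the parts (earlier components by induction)
  have hpart : ∀ q ∈ P.parts c, PGen.ClusterConn Zm (P.partPGen cell c (P.toPGen cell) q) →
      PGen.ClusterConn Zm (P.sortR.partPGen cell c (P.sortR.toPGen cell) q) := by
    intro q hq
    refine P.clusterConn_partPGen_sortR cell Zm c (fun c' hlt => ?_) hq
    exact clusterConn_toPGen_sortR hH hS hZ c'
  -- the parts' zones agree (zones read the births only)
  have hzone : ∀ q ∈ P.parts c, ∀ t,
      Zm t (P.sortR.partPGen cell c (P.sortR.toPGen cell) q) = Zm t (P.partPGen cell c (P.toPGen cell) q) :=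
    fun q _ t => hZ t _ _ (P.partPGen_sortR_agree cell hH hS c q).2.2.2
  cases hps : P.parts c with
  | nil =>
      rw [toPGen_of_nil cell P.sortR (P.parts_sortR_of_nil hps)]
      exact PGen.clusterConn_birth Zm _ _ _
  | cons p ps =>
      have hp : p ∈ P.parts c := by rw [hps]; exact List.mem_cons_self
      have hps_sub : ∀ q ∈ ps, q ∈ P.parts c := fun q hq => by rw [hps]; exact List.mem_cons_of_mem _ hq
      cases ps with
      | nil =>
          -- one part: both members ARE the part's `PGen`
          have hR : P.toPGen cell c = P.partPGen cell c (P.toPGen cell) p := by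
            rw [toPGen_of_cons cell P hps]; rfl
          have hS' : P.sortR.toPGen cell c = P.sortR.partPGen cell c (P.sortR.toPGen cell) p := by
            rw [P.toPGen_sortR_of_cons cell hps, List.mergeSort_nil]; rfl
          rw [hS']
          exact hpart p hp (hR ▸ H)
      | cons p' ps' =>
          -- at least two parts: both members are chains over closed members, same head, tail a permutation
          set f := P.partPGen cell c (P.toPGen cell) with hf
          set f' := P.sortR.partPGen cell c (P.sortR.toPGen cell) with hf'
          set qs := (p' :: ps').mergeSort fun q q' => decide (P.keyR c q ≤ P.keyR c q') with hqs
          have hperm : qs.Perm (p' :: ps') := P.sortTail_perm (p' :: ps')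
          have hqs_ne : qs ≠ [] := fun h0 => by
            have := hperm.length_eq; rw [h0] at this; simp at this
          have hR : P.toPGen cell c = chainJoin (f p) ((p' :: ps').map f) (P.step c) := toPGen_of_cons cell P hps
          have hSo : P.sortR.toPGen cell c = chainJoin (f' p) (qs.map f') (P.step c) :=
            P.toPGen_sortR_of_cons cell hps
          -- members closed at the step
          have hT : ∀ M ∈ f p :: (p' :: ps').map f, ∀ X Y, M ≠ PGen.join X Y (P.step c) := by
            intro M hM X Y
            obtain ⟨q, hq, rfl⟩ : ∃ q ∈ P.parts c, f q = M := by
              rcases List.mem_cons.1 hM with rfl | hM'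
              · exact ⟨p, hp, rfl⟩
              · obtain ⟨q, hq, rfl⟩ := List.mem_map.1 hM'
                exact ⟨q, hps_sub q hq, rfl⟩
            exact P.partPGen_ne_join_step cell hS c hq X Y
          have hT' : ∀ M ∈ f' p :: qs.map f', ∀ X Y, M ≠ PGen.join X Y (P.step c) := by
            intro M hM X Y
            obtain ⟨q, hq, rfl⟩ : ∃ q ∈ P.parts c, f' q = M := by
              rcases List.mem_cons.1 hM with rfl | hM'
              · exact ⟨p, hp, rfl⟩
              · obtain ⟨q, hq, rfl⟩ := List.mem_map.1 hM'
                exact ⟨q, hps_sub q (hperm.mem_iff.1 hq), rfl⟩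
            have := P.sortR.partPGen_ne_join_step cell (HistorySiblingEntropyBridge.renewDated_sortR P hS) c
              (P.mem_parts_sortR.2 hq) X Y
            simpa only [step_sortR] using this
          rw [hR] at H
          rw [hSo]
          obtain ⟨Htop, Hmem⟩ :=
            (PGen.clusterConn_chainJoin_iff Zm (P.step c) (f p) ((p' :: ps').map f) (by simp) hT).1 H
          refine (PGen.clusterConn_chainJoin_iff Zm (P.step c) (f' p) (qs.map f') (by simpa using hqs_ne) hT').2
            ⟨?_, ?_⟩
          · -- the top zone list of the twin is a permutation of the realised one
            have e1 : (f' p :: qs.map f').map (Zm (P.step c)) = (p :: qs).map (Zm (P.step c) ∘ f) := by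
              rw [← List.map_cons, List.map_map]
              exact List.map_congr_left fun q hq => by
                have hq' : q ∈ P.parts c := by
                  rcases List.mem_cons.1 hq with rfl | hq
                  · exact hp
                  · exact hps_sub q (hperm.mem_iff.1 hq)
                exact hzone q hq' _
            have e2 : (f p :: (p' :: ps').map f).map (Zm (P.step c)) =
                (p :: p' :: ps').map (Zm (P.step c) ∘ f) := by
              rw [← List.map_cons, List.map_map]
            rw [e1]
            rw [e2] at Htop
            exact tconn_of_perm ((hperm.cons p).map _).symm Htop
          · intro M hM
            rcases List.mem_cons.1 hM with rfl | hM'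
            · exact hpart p hp (Hmem _ List.mem_cons_self)
            · obtain ⟨q, hq, rfl⟩ := List.mem_map.1 hM'
              have hq' : q ∈ p' :: ps' := hperm.mem_iff.1 hq
              exact hpart q (hps_sub q hq') (Hmem _ (List.mem_cons_of_mem _ (List.mem_map.2 ⟨q, hq', rfl⟩)))
termination_by P.step c
decreasing_by exact hlt

end Summit.QuantumFields.BalabanUV.T4Continuum.HistoryGen.Pedigree

/-! ## §4 Sanity -/

namespace Summit.QuantumFields.BalabanUV.T4Continuum.HistoryMemberClusterConn.Sanity

open Summit.QuantumFields.BalabanUV.T4Continuum.HistoryAdmissible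

/-- with the constant member-zone `{0}` every member is cluster-connected (all zones meet): a chain of three births -/
example : PGen.ClusterConn (fun _ _ => ({0} : Finset ℕ))
    (chainJoin (PGen.birth 1 0 (7 : ℕ)) [PGen.birth 2 0 8, PGen.birth 3 1 9] 3) := by
  refine (PGen.clusterConn_chainJoin_iff _ 3 _ _ (by simp) ?_).2 ⟨?_, ?_⟩
  · intro M hM X Y
    simp only [List.mem_cons, List.not_mem_nil, or_false] at hM
    rcases hM with rfl | rfl | rfl <;> simp
  · intro p hp q hq
    refine Relation.ReflTransGen.single ⟨hp, hq, ?_⟩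
    simp only [List.map_cons, List.map_nil, List.mem_cons, List.not_mem_nil, or_false] at hp hq
    rcases hp with rfl | rfl | rfl <;> rcases hq with rfl | rfl | rfl <;> simp
  · intro M hM
    simp only [List.mem_cons, List.not_mem_nil, or_false] at hM
    rcases hM with rfl | rfl | rfl <;> exact PGen.clusterConn_birth _ _ _ _

end Summit.QuantumFields.BalabanUV.T4Continuum.HistoryMemberClusterConn.Sanity

end
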